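import Mathlib.LinearAlgebra.BilinearForm.Properties
import Mathlib.LinearAlgebra.FiniteDimensional.Lemmas
import Mathlib.LinearAlgebra.Dimension.Constructions
import Mathlib.Algebra.BigOperators.Fin
import Mathlib.Data.Real.Basic
import HarnessLib

/-!
# Completeness relations of a pseudo-orthonormal frame and of a lapse–shift tetrad

Linear algebra behind the last, spinor-free step of the rigid positive energy theorem
(Beig–Chruściel, J. Math. Phys. 37 (1996), Thm. 4.1, `m = 0`; named fact
`Literature.Geometry.Lorentzian.positive_mass_rigidity_spacetime` of
`SpacetimePositiveMassRigidity.lean`, architecture in `SpacetimePositiveMassRigidityProofs.lean`).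
There, four solutions `(N_a, Y_a)`, `a = 0, …, 3`, of the parallel Killing initial data system
on the data `(X, h, k)` have the constant Gram matrix `−N_a N_b + h(Y_a, Y_b) = η_{ab}`; at each
point `x` this says that `c ↦ (c^a N_a(x), c^a Y_a(x))` is an isometry of `(ℝ⁴, η)` onto
`ℝ ⊕ T_x X` with the Lorentz form `−s s' + h_x(v, v')`, and the **completeness relations**
`η^{ab} h(Y_a, v) h(Y_b, w) = h(v, w)`, `η^{ab} N_a h(Y_b, v) = 0`, `η^{ab} N_a N_b = −1` follow —
they are what makes the developing map `F = (f⁰, f¹, f², f³)`, `df^μ = η^{μa} h(Y_a, ·)`, an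
isometric immersion into Minkowski space with `−η^{ab} N_a ∂_b` as unit normal (the tetrad
identity `e^a_μ e^b_ν η_{ab} = g_{μν}` read on a slice; Wald 1984, §3.4b, (3.4.21)–(3.4.23)).
Everything here is elementary and proved (theorems only; no definition, no named fact):

* `eq_sum_smul_of_gram_eq`, `bilin_eq_sum_of_gram_eq` — **expansion and Parseval identity in a
  pseudo-orthonormal frame**: on a real vector space of dimension `n`, if `f₁, …, f_n` have Gram
  matrix `Q(f_a, f_b) = ε_a δ_{ab}` with `ε_a² = 1` for a bilinear form `Q`, then they form a
  basis with `z = ∑_a ε_a Q(z, f_a) f_a`, and for symmetric `Q`,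
  `Q(z, z') = ∑_a ε_a Q(z, f_a) Q(z', f_a)` (O'Neill 1983, Ch. 2, Lemma 2.25–2.26: orthonormal
  expansion in a scalar product space, `ε_a = ⟨f_a, f_a⟩`).
* `lapseShift_completeness` — the three completeness relations above for a **lapse–shift
  tetrad**: `N : Fin 4 → ℝ`, `Y : Fin 4 → V` on a `3`-dimensional real vector space `V` with a
  symmetric bilinear form `q` (no definiteness needed) and
  `−N_a N_b + q(Y_a, Y_b) = η_{ab} = diag(−1, 1, 1, 1)`; and `lapseShift_expanding`, the
  consequence `∑_{j=1}^{3} q(v, Y_j)² = q(v, v) + q(v, Y₀)²` (the spatial part of the developing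
  map does not decrease `h`-lengths).

## References

* B. O'Neill, *Semi-Riemannian geometry*, Academic Press 1983, Ch. 2, Lemmas 2.25–2.26
  (orthonormal expansion), Ch. 3, p. 55. [ONeillSemiRiemannian1983]
* R. M. Wald, *General Relativity*, Chicago 1984, §3.4b (orthonormal bases / tetrads).
  [Wald1984]
* R. Beig, P. T. Chruściel, J. Math. Phys. 37 (1996) 1939–1961, proof of Thm. 4.1 and App. A
  (the fields `(N, Yⁱ)`). [BeigChrusciel1996]
-/

noncomputable section

open Module

namespace Literature.Geometry.Lorentzian

section Parseval

variable {L : Type*} [AddCommGroup L] [Module ℝ L] [FiniteDimensional ℝ L] {n : ℕ}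

omit [FiniteDimensional ℝ L] in
/-- A family with invertible diagonal Gram matrix `Q(f_a, f_b) = ε_a δ_{ab}`, `ε_a ≠ 0`, is
linearly independent (pair a vanishing combination with each `f_b`). O'Neill 1983, Ch. 2,
Lemma 2.25. [cite: ONeillSemiRiemannian1983, Ch. 2, Lemma 2.25] -/
theorem linearIndependent_of_gram_eq (Q : LinearMap.BilinForm ℝ L) (ε : Fin n → ℝ)
    (hε : ∀ a, ε a ≠ 0) (f : Fin n → L) (hf : ∀ a b, Q (f a) (f b) = if a = b then ε a else 0) :
    LinearIndependent ℝ f := by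
  classical
  rw [Fintype.linearIndependent_iff]
  intro g hg b
  have h := congrArg (fun w ↦ Q w (f b)) hg
  simp only [LinearMap.BilinForm.sum_left, LinearMap.BilinForm.smul_left, hf, map_zero,
    LinearMap.zero_apply, mul_ite, mul_zero, Finset.sum_ite_eq', Finset.mem_univ, if_true] at h
  exact (mul_eq_zero.mp h).resolve_right (hε b)

/-- **Expansion in a pseudo-orthonormal frame.** On a real vector space of dimension `n`, let
`f : Fin n → L` have Gram matrix `Q(f_a, f_b) = ε_a δ_{ab}` with `ε_a² = 1` for a bilinear form
`Q`. Then every vector expands as `z = ∑_a ε_a Q(z, f_a) f_a` (the `f_a` are linearly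
independent, hence span, and the linear map `z ↦ ∑_a ε_a Q(z, f_a) f_a` fixes each `f_b`).
O'Neill 1983, Ch. 2, Lemma 2.26 (`ε_a = ⟨f_a, f_a⟩ = ±1`).
[cite: ONeillSemiRiemannian1983, Ch. 2, Lemma 2.26] -/
theorem eq_sum_smul_of_gram_eq (hn : finrank ℝ L = n) (Q : LinearMap.BilinForm ℝ L)
    (ε : Fin n → ℝ) (hε : ∀ a, ε a * ε a = 1) (f : Fin n → L)
    (hf : ∀ a b, Q (f a) (f b) = if a = b then ε a else 0) (z : L) :
    z = ∑ a, (ε a * Q z (f a)) • f a := by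
  classical
  have hε0 : ∀ a, ε a ≠ 0 := fun a h0 ↦ by simpa [h0] using hε a
  have hli := linearIndependent_of_gram_eq Q ε hε0 f hf
  have hspan : Submodule.span ℝ (Set.range f) = ⊤ :=
    hli.span_eq_top_of_card_eq_finrank' (by simp [hn])
  let Φ : L →ₗ[ℝ] L := ∑ a, (ε a • Q.flip (f a)).smulRight (f a)
  have hΦ : ∀ w, Φ w = ∑ a, (ε a * Q w (f a)) • f a := fun w ↦ by
    simp [Φ, LinearMap.sum_apply, LinearMap.smulRight_apply, smul_eq_mul]
  have hgen : ∀ b, Φ (f b) = (LinearMap.id : L →ₗ[ℝ] L) (f b) := by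
    intro b
    rw [hΦ, LinearMap.id_apply]
    simp only [hf]
    have : ∀ a, (ε a * if b = a then ε b else 0) • f a = if b = a then f b else 0 := by
      intro a
      split_ifs with hab
      · subst hab; rw [hε, one_smul]
      · rw [mul_zero, zero_smul]
    simp only [this, Finset.sum_ite_eq, Finset.mem_univ, if_true]
  have hid : Φ = LinearMap.id := LinearMap.ext_on_range hspan hgen
  have hz := LinearMap.congr_fun hid z
  rw [LinearMap.id_apply, hΦ] at hz
  exact hz.symm

/-- **Parseval identity in a pseudo-orthonormal frame.** Under the hypotheses of
`eq_sum_smul_of_gram_eq` and for *symmetric* `Q`: `Q(z, z') = ∑_a ε_a Q(z, f_a) Q(z', f_a)`.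
O'Neill 1983, Ch. 2, Lemma 2.26. [cite: ONeillSemiRiemannian1983, Ch. 2, Lemma 2.26] -/
theorem bilin_eq_sum_of_gram_eq (hn : finrank ℝ L = n) (Q : LinearMap.BilinForm ℝ L)
    (hQ : ∀ x y, Q x y = Q y x) (ε : Fin n → ℝ) (hε : ∀ a, ε a * ε a = 1) (f : Fin n → L)
    (hf : ∀ a b, Q (f a) (f b) = if a = b then ε a else 0) (z z' : L) :
    Q z z' = ∑ a, ε a * Q z (f a) * Q z' (f a) := by
  conv_lhs => rw [eq_sum_smul_of_gram_eq hn Q ε hε f hf z]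
  rw [LinearMap.BilinForm.sum_left]
  refine Finset.sum_congr rfl fun a _ ↦ ?_
  rw [LinearMap.BilinForm.smul_left, hQ (f a) z', mul_assoc]

end Parseval

/-! ### Lapse–shift tetrads -/

section LapseShift

variable {V : Type*} [AddCommGroup V] [Module ℝ V] [FiniteDimensional ℝ V]

/-- **Completeness relations of a lapse–shift tetrad.** Let `V` be a `3`-dimensional real
vector space with a symmetric bilinear form `q`, and let `N : Fin 4 → ℝ`, `Y : Fin 4 → V` have
the Minkowski Gram matrix `−N_a N_b + q(Y_a, Y_b) = η_{ab} = diag(−1, 1, 1, 1)`. Then, with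
`η^{aa} = η_{aa} = ∓1`: (i) `∑_a η^{aa} q(v, Y_a) q(w, Y_a) = q(v, w)`;
(ii) `∑_a η^{aa} N_a q(v, Y_a) = 0`; (iii) `∑_a η^{aa} N_a² = −1`. (Apply
`bilin_eq_sum_of_gram_eq` on `ℝ × V` with the Lorentz form `−s s' + q(v, v')`, of which
`a ↦ (N_a, Y_a)` is a pseudo-orthonormal frame, to the pairs `((0,v),(0,w))`, `((1,0),(0,v))`,
`((1,0),(1,0))`.) In Minkowski space these are the tetrad identities
`η^{ab} e_a^μ e_b^ν = g^{μν}` for the parallel frame `e_a = N_a n + Y_a` decomposed along a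
spacelike slice with unit normal `n`; Wald 1984, §3.4b; Beig–Chruściel 1996, proof of
Thm. 4.1 (the fields `(N, Yⁱ)` of App. A). [cite: Wald1984, §3.4b] -/
theorem lapseShift_completeness (hV : finrank ℝ V = 3) (q : LinearMap.BilinForm ℝ V)
    (hq : ∀ v w, q v w = q w v) (N : Fin 4 → ℝ) (Y : Fin 4 → V)
    (hG : ∀ a b, -(N a * N b) + q (Y a) (Y b) =
      if a = b then (if a = 0 then -1 else 1) else 0) :
    (∀ v w, q v w = ∑ a, (if a = 0 then -1 else 1 : ℝ) * q v (Y a) * q w (Y a)) ∧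
    (∀ v, ∑ a, (if a = 0 then -1 else 1 : ℝ) * N a * q v (Y a) = 0) ∧
    ∑ a, (if a = 0 then -1 else 1 : ℝ) * N a ^ 2 = -1 := by
  -- the Lorentz form on `ℝ × V`
  let Q : LinearMap.BilinForm ℝ (ℝ × V) :=
    q.compl₁₂ (LinearMap.snd ℝ ℝ V) (LinearMap.snd ℝ ℝ V) -
      (LinearMap.mul ℝ ℝ).compl₁₂ (LinearMap.fst ℝ ℝ V) (LinearMap.fst ℝ ℝ V)
  have hQ : ∀ z z' : ℝ × V, Q z z' = -(z.1 * z'.1) + q z.2 z'.2 := fun z z' ↦ by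
    simp only [Q, LinearMap.sub_apply, LinearMap.compl₁₂_apply, LinearMap.snd_apply,
      LinearMap.fst_apply, LinearMap.mul_apply']
    ring
  have hQs : ∀ z z' : ℝ × V, Q z z' = Q z' z := fun z z' ↦ by
    rw [hQ, hQ, hq z.2, mul_comm z.1]
  have hn : finrank ℝ (ℝ × V) = 4 := by rw [finrank_prod, finrank_self, hV]
  set ε : Fin 4 → ℝ := fun a ↦ if a = 0 then -1 else 1 with hε_def
  have hε : ∀ a, ε a * ε a = 1 := fun a ↦ by
    simp only [hε_def]; split_ifs <;> norm_num
  set f : Fin 4 → ℝ × V := fun a ↦ (N a, Y a) with hf_def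
  have hf : ∀ a b, Q (f a) (f b) = if a = b then ε a else 0 := fun a b ↦ by
    rw [hQ]; exact hG a b
  have P := bilin_eq_sum_of_gram_eq hn Q hQs ε hε f hf
  refine ⟨fun v w ↦ ?_, fun v ↦ ?_, ?_⟩
  · have h := P (0, v) (0, w)
    simp only [hQ, hf_def, zero_mul, neg_zero, zero_add] at h
    exact h
  · have h := P (1, 0) (0, v)
    simp only [hQ, hf_def, one_mul, mul_zero, zero_mul, neg_zero, map_zero,
      LinearMap.zero_apply, add_zero, zero_add] at h
    -- h : 0 = ∑ a, ε a * -N a * q v (Y a)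
    have : ∑ a, ε a * N a * q v (Y a) = -∑ a, ε a * -N a * q v (Y a) := by
      rw [← Finset.sum_neg_distrib]
      exact Finset.sum_congr rfl fun a _ ↦ by ring
    rw [this, ← h, neg_zero]
  · have h := P (1, 0) (1, 0)
    simp only [hQ, hf_def, one_mul, mul_one, map_zero, LinearMap.zero_apply, add_zero] at h
    -- h : -1 = ∑ a, ε a * -N a * -N a
    have h' : ∑ a, ε a * N a ^ 2 = ∑ a, ε a * -N a * -N a :=
      Finset.sum_congr rfl fun a _ ↦ by ring
    rw [h']
    exact h.symm

/-- **The spatial part of a lapse–shift tetrad is expanding**: under the hypotheses of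
`lapseShift_completeness`, `∑_{j=1}^{3} q(v, Y_j)² = q(v, v) + q(v, Y₀)²` for every `v` (relation
(i) with `w = v`, the term `a = 0` moved across). For positive semi-definite `q` this says that
`v ↦ (q(v, Y₁), q(v, Y₂), q(v, Y₃))` does not decrease `q`-lengths — the step of the rigidity
argument making the spatial part of the developing map a covering of `ℝ³`. Wald 1984, §3.4b;
Beig–Chruściel 1996, proof of Thm. 4.1. [cite: Wald1984, §3.4b] -/
theorem lapseShift_expanding (hV : finrank ℝ V = 3) (q : LinearMap.BilinForm ℝ V)
    (hq : ∀ v w, q v w = q w v) (N : Fin 4 → ℝ) (Y : Fin 4 → V)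
    (hG : ∀ a b, -(N a * N b) + q (Y a) (Y b) =
      if a = b then (if a = 0 then -1 else 1) else 0) (v : V) :
    ∑ j : Fin 3, q v (Y j.succ) ^ 2 = q v v + q v (Y 0) ^ 2 := by
  have h := (lapseShift_completeness hV q hq N Y hG).1 v v
  rw [Fin.sum_univ_succ] at h
  simp only [if_true, Fin.succ_ne_zero, if_false, one_mul] at h
  rw [h]
  simp only [pow_two]
  ring

end LapseShift

end Literature.Geometry.Lorentzian

end
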